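import Mathlib
import HarnessLib
import HarnessLib.Audit
import Summits.Schanuel.Statement
import Literature.ModelTheory.ExponentialFields.Languages
import Literature.NumberTheory.Transcendental.RoyCriterion
import Literature.NumberTheory.Transcendental.ExpVarieties
import HarnessLib.Audit.Status.Attr

/-!
Route: RigidCore

DORMANT since 2026-08-24T05:10:42Z (reconciler: no traction for 6.6 d (last activity item-evidence-added at 2026-08-17T15:10:40Z); parked, not closed — `ledger route dormant route-Schanuel-RigidCore --off` to reactivate) — unstaffed, not closed; items shared with open routes are served there. `ledger route dormant <id> --off` reactivates.

Thesis X (cards Schanuel/Schanuel/branch-indiscernibility-rigid-core-v3 +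
Schanuel/Schanuel/period-lattice-rigidity-baker): it suffices to show the three-part localisation
  (S*) MinimalCounterexampleInAcl — a first-failure counterexample to Schanuel (x ℚ-linearly
independent, trdeg ℚ(x, e^x) < n, SchanuelRank r for all r < n) has every coordinate in
acl^{ℂ_exp}(∅), the union of the FINITE ∅-definable subsets of the structure (ℂ, +, ·, exp)
[sharpens Kirby2010 Prop 7.2 'essential counterexamples ⊂ ecl(∅)' from exponential-algebraic to
first-order-algebraic; its arithmetic content is SPARSITY (finitely many ℚ-independent graph points
on a ℚ-variety of dimension < n: o-minimal counting + Baker) plus definable isolation];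
  (A) AclSubsetLogFreeCore — acl^{ℂ_exp}(∅) ⊆ C_EA := the smallest relatively algebraically closed,
exp-closed subfield of ℂ containing 2πi (the LOG-FREE core; 'ℂ_exp does not know which logarithm is
real'); a pure SYMMETRY/definability statement, the part of Zilber's picture that does not contain
SC;
  (R) SchanuelOnLogFreeCore — Schanuel's conjecture for tuples from C_EA ('Schanuel without
logarithms': e ⊥ π, e^{π²} ∉ ℚ̄, e ⊥ e^e live here; log 2 ⊥ π, log 2 ⊥ 2^√2, fixed points of exp do
NOT — they sit on the symmetric side).
Lean (route decls; acl and C_EA inlined over Mathlib's `Set.Definable₁ ∅ Language.expRing` and `sInf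
{K : IntermediateField ℚ ℂ | 2πi ∈ K ∧ exp-closed ∧ relatively algebraically closed}`):
  X := MinimalCounterexampleInAcl ∧ AclSubsetLogFreeCore ∧ SchanuelOnLogFreeCore, and Assembly :=
MinimalCounterexampleInAcl → AclSubsetLogFreeCore → SchanuelOnLogFreeCore → Schanuel (strong
induction on the rank n; kernel-checked in the planner sketch, axioms
propext/Classical.choice/Quot.sound).
Two-layer plan: layer 1 = the three cruxes + the geometric n = 2 sparsity crux SparsityTwo, which
feeds (S*) through the glue MinimalCounterexampleInAclOfSparsityTwo : SparsityTwo →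
MinimalCounterexampleInAclGeThree → MinimalCounterexampleInAcl (support, provable now —
kernel-checked planner certificate, rev 4: ranks ≤ 1 carry no first failure; at rank 2 the point (x,
e^x) lies on a ℚ-variety of zariskiDim < 2 (tree TrdegZariskiDimConverse), its locus mates sit
inside SparsityTwo's finite set, and definable isolation is FREE because ℤ, hence ℚ-linear
independence, is ∅-definable in ℂ_exp (Theorems …/MinimalCounterexampleInAcl/Negative/IsolationFree)
— no uniformity lemma is needed) together with the rank-6 crux MinimalCounterexampleInAclGeThree =
(S*) for n ≥ 3; glue later = (ii) instance table of (A): BI₂ / one endomorphism moving log 2 ⇒ π ⊥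
log 2 (filed now as the provable support EndomorphismMovingLogTwo), fixed-point indiscernibility ⇒
Marker's corollary. Unconditional hinge theorems (Baker + ℚ-Zariski closure:
OneLogBranchRelationFinite, TwoLogsBranchRelationFinite; definability bookkeeping
LogFreeCoreSubsetAcl) are support items provable now.

Rationale: WHY THIS LINE (imports: model theory of ℂ_exp — first-order definability/acl, Kirby–Zilber
homogeneity run BACKWARDS; o-minimal counting + Baker for sparsity). Every proved instance of
Schanuel is either rigid-and-shallow (LW, Nesterenko at CM data) or uniform in the branch of log
(Baker, Gel'fond–Schneider hold for all determinations at once); a theorem true of one branch and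
false of another has never been proved, and card branch-indiscernibility-rigid-core-v3 (T1) shows
such a theorem about log 2 would refute Zilber's conjecture. The route makes this precise: Kirby2010
(arXiv:0810.4285 Prop 7.2, tree schanuelConjecture_iff_ecl_empty_holds) localises SC to ecl(∅);
E-derivations vanish there (barrier AxSchanuelFunctionalNotNumerical), so the next localisation must
use non-functional input. We localise further to acl^{ℂ_exp}(∅) by SPARSITY (S*: archimedean —
Pila–Wilkie/BNZ counting arXiv:2202.05305, Baker via period-lattice-rigidity-baker's Theorem L,
pell-orbit-analyticity-shapiro's Theorem P for n = 2) and then split acl(∅) by SYMMETRY (A: acl is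
log-free, the ℂ-analogue of what Kirby FPEF arXiv:0912.4019 §9 / KMO arXiv:1101.4224 prove inside 𝔹)
from the ARITHMETIC core (R: SC on the EA-closure of ℚ(2πi), Macintyre's free-E-ring sector; cf.
Edmundo–Terzo 2008 'On freely generated E-subrings', Wilkie's SC for non-∅-definable reals). Value
even if no crux closes: every Schanuel instance is sorted into 'attack by symmetry/definability' vs
'attack by arithmetic', and the instance reductions land as theorems (EndomorphismMovingLogTwo: ONE
exponential-ring endomorphism of ℂ moving ln 2 proves π ⊥ log 2 — Mycielski's question, Nathanson
arXiv:2209.01027 §4, becomes a transcendence criterion; uses only transcendental_pi_holds).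
RANKED CRUXES. rank 2 AclSubsetLogFreeCore (A) — hardest informative, no known handle on
∅-definability in ℂ_exp beyond KMO's kernel/cyclotomic rigidity; rank 3 MinimalCounterexampleInAcl
(S*) — sparsity + definable isolation, partial theorems exist at n = 2; rank 4 SchanuelOnLogFreeCore
(R) — the irreducible arithmetic core (contains e ⊥ π); rank 5 SparsityTwo — geometric finiteness
for ℚ-curves in 𝔾_a²×𝔾_m², open exactly on Shapiro/Dirichlet atoms; rank 6
MinimalCounterexampleInAclGeThree — the n ≥ 3 slice of (S*), co-premise of the SparsityTwo glue (its
open content is first-failure sparsity for n ≥ 3, Conjecture-L∞ / weak-CIT strength; the S* line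
kernel-arithmetic-selection proves it verbatim, and any proof of (S*) closes it in one line).
Supports (rank 9, provable now): MinimalCounterexampleInAclOfSparsityTwo (GLUE SparsityTwo →
MinimalCounterexampleInAclGeThree → MinimalCounterexampleInAcl, ~25 lines over landed theorems
firstFailure_two_le / isolationFree / exists_definedOver_mem_zariskiDim_lt_iff; certificate attached
to stmt-Schanuel-14765), LogFreeCoreSubsetAcl (definition audit: ℤ, ±2πi ∅-definable; acl closed
under exp, field ops, roots), EndomorphismMovingLogTwo (Lindemann only, ~250 lines),
OneLogBranchRelationFinite (B1) and TwoLogsBranchRelationFinite (Theorem L, m = 2) over the PROVED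
tree facts baker_holds / transcendental_pi_holds (~300 lines each; refuter-triage-16 re-proved both
on paper by a transporter argument).
KILL CRITERIA. (A) refuted — e.g. a finite set of branches of log 2, or ℝ, shown ∅-definable in
ℂ_exp — closes the route (Schanuel untouched; it would also refute Zilber's conjecture). (S*)
refuted needs an actual Schanuel counterexample outside acl(∅): closes every route. SparsityTwo
refuted = infinitely many ℚ-independent solutions of an overdetermined exponential system over ℚ in
two unknowns: refutes SC(2). (R) refuted refutes SC.
NOT DECOMPOSED YET. The positive-existential indiscernibility BI_q and fixed-point indiscernibility
(need a pos-∃ formula API over Language.expRing); the endomorphism-of-the-countable-core form (needs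
ecl ∅ as an E-field: Kirby2010_ecl_isExpSubfield); (RESOLVED rev 4: no uniformity lemma is needed to
turn SparsityTwo into (S*) at n = 2 — ℚ-linear independence is ∅-definable, so the independent locus
mates are already an ∅-definable finite set; glue MinimalCounterexampleInAclOfSparsityTwo filed) L1
(acl^𝔹(∅) = EA-closure of ℚ(τ), a statement about 𝔹 only); sparsity for n ≥ 3 (Conjecture L∞ of
period-lattice-rigidity-baker); definition requests expAcl / logFreeCore to replace the inlined
set-builders.
CHEAPEST FALSIFIER. For the line as a whole: exhibit ONE parameter-free formula of (ℂ, +, ·, exp)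
isolating a finite set of branches {ln 2 + 2πik} (or a finite set of fixed points of exp) — that
refutes (A) outright and closes the route (KMO arXiv:1101.4224 §2 record only kernel/ℚ^ab rigidity,
so this is a short literature-and-argument audit, not a computation); on the sparsity side no cheap
numerical kill exists (cdisprove of stmt-Schanuel-0971: SparsityTwo is SC(2)-implied, false without
each of its three hypotheses, tight at dim < 3; calibration e^c ≠ d for rationals is
Hermite–Lindemann); the glue item is certified, so its only falsifier is a type error on re-render.
CONSIDERED AND NOT USED: probabilistic models (SC holds a.e., no transfer); physical analogies (none
with a dictionary); the real field ℝ_exp (its dcl(∅) contains log 2 — the symmetric/rigid split is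
invisible there, which is exactly why the route lives in ℂ_exp).

Novelty: Searched 2026-08-15 (this planner): lit galaxy search --star all "automorphism of the complex
exponential field" / "essential counterexample to Schanuel" (0 rows each); lit galaxy search --star
pdf --mode bm25 "exponentially closed fields definable sets Schanuel conjecture algebraic closure of
the empty set" (15 rows: D'Aquino–Macintyre–Terzo Schanuel Nullstellensatz; Edmundo–Terzo 'On freely
generated E-subrings' modnet preprint 134 (2008) READ pp.1,4–6: Thm 1.1/3.5/3.6 = Wilkie's SC for
reals NOT ∅-definable in ℝ_exp via o-minimal derivations + Ax; Haykazyan–Kirby arXiv:1812.08271;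
Kirby TEDESV); lit read arXiv:0912.4019 §9–10 (READ p.23–25: Thm 9.2 'SC decides all particular
transcendence problems' via homogeneity of B₀ — the converse direction; 'SC ⟺ C₀ embeds in B₀';
Problems (1)–(7)); lit read arXiv:2209.01027 (READ pp.1–4: Mycielski's question whether every
exponential automorphism fixes ln 2, answered only mod 2πiℤ; §4 open problem); lit search/vsearch
UNAVAILABLE (searchd rc 75, three attempts) — searched-but-not-exhaustive, plus the two cards' own
documented searches (KMO arXiv:1101.4224 read; Bays–Kirby arXiv:1512.04262 §9.2; zbMATH queries for
relations between branches of logarithms: nothing). Nearest prior art: Kirby2010 = arXiv:0810.4285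
Prop 7.2 (counterexamples ⊂ ecl(∅); tree schanuelConjecture_iff_ecl_empty_holds) and Kirby FPEF
arXiv:0912.4019 Thm 9.2 (homogeneity + SC ⇒ decisions); Edmundo–Terzo 2008 / Wilkie (undefinability
in the o-minimal ℝ_exp ⇒ relati  [refs: 1812.08271, 0912.4019, 2209.01027, 1101.4224, 1512.04262, 0810.4285, Kirby2010, BakerTNT1975]

Barriers (technique_class: acl-core-definability symmetry o-minimal-sparsity baker): technique_class: acl-core-definability symmetry o-minimal-sparsity baker
- Literature.Barriers.Schanuel.AxSchanuelFunctionalNotNumerical: APPLIES to any attempt to prove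
(S*) by derivations and is the reason the route exists: E-derivations vanish on ecl(∅) ⊋ acl(∅)
(eDerivation_apply_eq_zero_of_mem_ecl_empty), so Kirby's localisation cannot be pushed inside ecl(∅)
functionally; (S*) is pushed by ARCHIMEDEAN input instead (o-minimal counting of sheets/moduli,
Baker on the period lattice) — evaded by changing the input class, at the price that (S*) is open.
- Literature.Barriers.Schanuel.AxiomsDoNotForceSchanuel: respected by construction — Bays–Kirby's
𝔹_P are homogeneous fields where SP fails only inside a finite-dimensional definable core; the route
claims for symmetry only (A) (which 𝔹_P-type models also satisfy) and puts the whole failure mode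
into (R); no 'ℂ ≅ 𝔹 hence SC' step.
- Literature.Barriers.Schanuel.SchanuelPropertyNotFirstOrder: (A) and (S*) are statements about ONE
structure ℂ_exp (finite ∅-definable sets), not a first-order axiomatisation or transfer of SP;
ultraproducts irrelevant; noted that acl-membership quantifies over formulas and is used as a
hypothesis, never axiomatised.
- Literature.Barriers.Schanuel.AlgebraicIndependenceOfLogarithms (linear-forms-in-logarithms,
strength): Baker is used exactly at its proved linear strength (baker_holds) inside the
hinge/support items; the route's outputs π ⊥ log 2 etc. are CONDITIONAL on (A)-instances; (R)
restricte

History (route lifecycle, newest last):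
- 2026-08-24T05:10:42Z · DORMANT — reconciler: no traction for 6.6 d (last activity item-evidence-added at 2026-08-17T15:10:40Z); parked, not closed — `ledger route dormant route-Schanuel-RigidCo (operator:999:3163352)

sub-problem: Schanuel · status: dormant · opened planner-plancards-Schanuel-Schanuel-20260815w1-3-0 2026-08-15T10:38:32Z · rev 5 · ledger route-Schanuel-RigidCore
GENERATED by the gate from the ledger (D-0016/17). Provers cite these decls: `theorem foo : Summit.Schanuel.Schanuel.Theses.RigidCore.<Decl> := …` in Summits/Schanuel/Schanuel/Theorems/<Name>.lean.
-/

namespace Summit.Schanuel.Schanuel.Theses.RigidCore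

open scoped BigOperators Topology Manifold Classical MeasureTheory ProbabilityTheory Matrix InnerProductSpace ComplexConjugate ContinuousMap
open Filter Set Function TopologicalSpace MeasureTheory

attribute [summit_statement] _root_.Schanuel

open Literature.Periods

/-- item stmt-Schanuel-0968 · crux · rank 2 · open · by planner
why it might fail: False if R (or a finite set like {real ln 2}) is 0-definable in C_exp: then ln 2 is in acl(0) but, under SC, not in C_EA. Non-definability of R in C_exp is open (Koiran's conjecture: Pila2022 pp.59-60; KMO arXiv:1101.4224 p.2 'two main open questions'); no handle beyond kernel/Q^ab rigidity.
sources: arXiv:1101.4224, Pila2022, arXiv:0912.4019, arXiv:1512.04262, Marker2006, Zilber2005PseudoExp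
[crux] (A) acl^{C_exp}(emptyset) ⊆ C_EA: every element of a FINITE emptyset-definable subset of
(C,+,*,exp) lies in the log-free core C_EA = smallest relatively algebraically closed, exp-closed
subfield of C containing 2*pi*i. Pure symmetry/definability statement ('C_exp does not know which
logarithm is real'); instances: branch indiscernibility BI_2 (=> pi ⊥ log 2 via B1), fixed-point
indiscernibility (=> Marker's corollary), KMO_2(C). Implied by Zilber's conjecture + L1
(acl^B(emptyset) = EA-closure of Q(tau)); NOT implied by SC. Sources: card
branch-indiscernibility-rigid-core-v3 (T0-T3, C1, L1); Kirby FPEF arXiv:0912.4019 Thm 9.2 and sec.9;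
KMO arXiv:1101.4224; BaysKirby2018ANT arXiv:1512.04262 sec.9.2. -/
@[route_item "route-Schanuel-RigidCore", crux]
def AclSubsetLogFreeCore : Prop :=
  ∀ a : ℂ, (∃ s : Set ℂ, s.Finite ∧ Set.Definable₁ (∅ : Set ℂ) Literature.ModelTheory.ExponentialFields.Language.expRing s ∧ a ∈ s) → a ∈ (sInf {K : IntermediateField ℚ ℂ | (2 * ↑Real.pi * Complex.I : ℂ) ∈ K ∧ (∀ w ∈ K, Complex.exp w ∈ K) ∧ ∀ w : ℂ, IsAlgebraic K w → w ∈ K} : IntermediateField ℚ ℂ)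

/-- item stmt-Schanuel-0969 · crux · rank 3 · open · by planner
why it might fail: Past Kirby Prop 7.2 (first-failure counterexamples lie in ecl(0)) all is open even at n=2: (i) finiteness of Q-independent graph points on Q-varieties of dim<n is Shapiro-conjecture strength, known only under SC (arXiv:1206.6747 s.5; arXiv:2503.20345 Thm 1.7); (ii) 0-definable isolation is unproved.
sources: arXiv:0810.4285, arXiv:1206.6747, arXiv:2503.20345, arXiv:2202.05305, BakerTNT1975, Literature.NumberTheory.Transcendental.schanuelConjecture_iff_ecl_empty_holds (tree, PROVED: Literature/NumberTheory/Transcendental/KirbyWeakSchanuelAx.lean:578)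
[crux] (S*) a first-failure counterexample to Schanuel (x Q-linearly independent in C^n, trdeg
Q(x,e^x) < n, SchanuelRank r for all r < n) has all coordinates in acl^{C_exp}(emptyset). Sharpens
Kirby2010 Prop 7.2 (essential counterexamples ⊂ ecl(emptyset), tree
schanuelConjecture_iff_ecl_empty_holds) from exponentially-algebraic to first-order algebraic;
vacuous under SC. Content: SPARSITY (the Q-Zariski closure W of (x,e^x) has dim < n; finitely many
Q-independent graph points on W: o-minimal counting arXiv:2202.05305 + Baker, cards
period-lattice-rigidity-baker Thm L / pell-orbit-analyticity-shapiro Thm P /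
sparse-sheets-wilkie-counting T2) + DEFINABLE ISOLATION (W ∩ Gamma is emptyset-definable; dependent
solutions removed by finitely many 'sum m_i x_i ≠ 0'). Sources: card
branch-indiscernibility-rigid-core-v3 T3 (+ refuter-triage-16 gap note); Kirby2010 arXiv:0810.4285
Prop 7.2, Thm 1.4. -/
@[route_item "route-Schanuel-RigidCore", crux]
def MinimalCounterexampleInAcl : Prop :=
  ∀ (n : ℕ) (x : Fin n → ℂ), LinearIndependent ℚ x → Algebra.trdeg ℚ ↥(IntermediateField.adjoin ℚ (Set.range x ∪ Set.range (Complex.exp ∘ x))) < (n : Cardinal) → (∀ r < n, Literature.NumberTheory.Transcendental.SchanuelRank r) → ∀ i, ∃ s : Set ℂ, s.Finite ∧ Set.Definable₁ (∅ : Set ℂ) Literature.ModelTheory.ExponentialFields.Language.expRing s ∧ x i ∈ s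

/-- item stmt-Schanuel-0970 · crux · rank 4 · open · by planner
why it might fail: Contains e alg. indep. of pi (x=(1, pi i)) and e^{pi^2} transcendental: 'SC is considered out of reach, since even the very simple consequence that e and pi are algebraically independent is unknown' (arXiv:1512.04262 p.3). The route isolates C_EA but supplies no transcendence engine for it.
sources: arXiv:1512.04262, arXiv:0912.4019, BakerTNT1975, Waldschmidt2000, EdmundoTerzo2009
[crux] (R) 'Schanuel without logarithms': SC for Q-linearly independent tuples from C_EA (smallest
relatively algebraically closed exp-closed subfield of C containing 2*pi*i = the EA-closure of the
kernel field inside C; Kirby FPEF sec.2/9: SK^{EA}). Contains e ⊥ pi (x=(1, pi i)), e^{pi^2}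
transcendental (x=(pi i, pi^2)), e ⊥ e^e; excludes log 2 ⊥ pi, 2^sqrt2, fixed points (symmetric
side). The irreducible arithmetic core: every symmetric method is void here (all data
emptyset-definable), so it isolates what needs genuinely arithmetic input (cards
e-pi-obstruction-tate-gevrey, tensor-mixed-gevrey-division; Macintyre's free E-ring question;
EdmundoTerzo2009 Thm 1.1/3.6 for the undefinable-in-R_exp analogue via Wilkie's o-minimal
derivations). Sources: card branch-indiscernibility-rigid-core-v3 C2; Kirby FPEF arXiv:0912.4019
sec.9; Macintyre APAL 51 (1991); Waldschmidt2000 sec.1.4. -/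
@[route_item "route-Schanuel-RigidCore", crux]
def SchanuelOnLogFreeCore : Prop :=
  ∀ (n : ℕ) (x : Fin n → ℂ), (∀ i, x i ∈ (sInf {K : IntermediateField ℚ ℂ | (2 * ↑Real.pi * Complex.I : ℂ) ∈ K ∧ (∀ w ∈ K, Complex.exp w ∈ K) ∧ ∀ w : ℂ, IsAlgebraic K w → w ∈ K} : IntermediateField ℚ ℂ)) → LinearIndependent ℚ x → (n : Cardinal) ≤ Algebra.trdeg ℚ ↥(IntermediateField.adjoin ℚ (Set.range x ∪ Set.range (Complex.exp ∘ x)))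

/-- item stmt-Schanuel-0971 · crux · rank 5 · open · by planner
why it might fail: Open on Gamma-symmetric Q-curves (non-linear exponent dependence, non-torsion phases): finiteness of coincidences is Shapiro-type, known only for Ritt-simple cases via Skolem-Mahler-Lech (arXiv:1206.6747 s.3) or under SC (arXiv:2503.20345 Thm 1.7); BNZ arXiv:2202.05305 gives polylog counts only.
sources: arXiv:1206.6747, arXiv:2503.20345, arXiv:2202.05305, BakerTNT1975, Pila2022, DaquinoMacintyreTerzo2014
[crux] Geometric sparsity at n=2: a Zariski-closed W ⊂ C^2 x C^2 defined over Q (IsDefinedOver ⊥) of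
dimension < 2 carries only finitely many graph points (x, e^x) with x Q-linearly independent (SC(2)
predicts none). Known pieces: non-Gamma-symmetric curves by o-minimal modulus splitting (card
modulus-first-certification F'), finite-y-projection symmetric curves by Baker
(period-lattice-rigidity-baker Thm L, support TwoLogsBranchRelationFinite), one real-quadratic slope
with torsion phases (pell-orbit-analyticity-shapiro Thm P), two independent algebraic slopes
(Schmidt subspace); polylog sparsity for all curves off {q.x=0} by BNZ arXiv:2202.05305
(sparse-sheets-wilkie-counting T2). Feeds MinimalCounterexampleInAcl at n=2. Sources: cards
pell-orbit-analyticity-shapiro, period-lattice-rigidity-baker, sparse-sheets-wilkie-counting;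
D'Aquino-Macintyre-Terzo arXiv:1206.6747; Fischler-Rivoal arXiv:2503.20345 Thm 1.7/4.1. -/
@[route_item "route-Schanuel-RigidCore", crux]
def SparsityTwo : Prop :=
  ∀ (W : Set (Fin 2 ⊕ Fin 2 → ℂ)), Literature.NumberTheory.Transcendental.IsDefinedOver (⊥ : Subfield ℂ) W → Literature.NumberTheory.Transcendental.zariskiDim ℂ W < 2 → Set.Finite {x : Fin 2 → ℂ | LinearIndependent ℚ x ∧ Sum.elim x (Complex.exp ∘ x) ∈ W}

/-- item stmt-Schanuel-14744 · crux · rank 6 · open · by planner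
why it might fail: Open: first-failure sparsity for n ≥ 3 (finitely many ℚ-independent locus mates on a ℚ-variety of dim < n in 𝔾_aⁿ×𝔾_mⁿ) is weak-CIT/Zilber–Pink strength; nothing unconditional beyond Kirby 2010 Prop 7.2 (ecl-version) and BNZ polylog counts; Bays–Kirby 𝔹_P: axioms alone do not force it.
sources: arXiv:0810.4285, arXiv:1512.04262, arXiv:2202.05305, arXiv:1101.4224
[crux] (S*) for ranks n ≥ 3 — the verbatim slice `3 ≤ n` of MinimalCounterexampleInAcl: a
first-failure counterexample to Schanuel of rank n ≥ 3 (x ℚ-linearly independent, trdeg ℚ(x, e^x) <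
n, SchanuelRank r for all r < n) has every coordinate in a finite ∅-definable subset of ℂ_exp = (ℂ,
+, ·, exp). Filed (route-repair 2026-08-16, unused-crux) as the co-premise of the glue
MinimalCounterexampleInAclOfSparsityTwo : SparsityTwo → MinimalCounterexampleInAclGeThree →
MinimalCounterexampleInAcl, which puts the staffed rank-2 sparsity crux SparsityTwo into the cone of
`closes` (ranks ≤ 1 carry no first failure; rank 2 = SparsityTwo + 'isolation is free'). By
isolationFree (Theorems/MinimalCounterexampleInAcl/Negative/IsolationFree.lean, landed: ℤ is
∅-definable in ℂ_exp, so ℚ-linear independence is one ∅-formula and the locus condition is finitely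
many ℚ-relations by Hilbert basis) its open content is pure finiteness: a first failure of rank n ≥
3 has only finitely many ℚ-linearly independent locus mates (sparsity of ℚ-independent graph points
on ℚ-varieties of dimension < n in 𝔾_aⁿ × 𝔾_mⁿ). The S* line kernel-arithmetic-selection
(Cruxes/MinimalCounterexampleInAcl/PICKED.md; landed stu -/
@[route_item "route-Schanuel-RigidCore", crux]
def MinimalCounterexampleInAclGeThree : Prop :=
  ∀ (n : ℕ), 3 ≤ n → ∀ (x : Fin n → ℂ), LinearIndependent ℚ x → Algebra.trdeg ℚ ↥(IntermediateField.adjoin ℚ (Set.range x ∪ Set.range (Complex.exp ∘ x))) < (n : Cardinal) → (∀ r < n, Literature.NumberTheory.Transcendental.SchanuelRank r) → ∀ i, ∃ s : Set ℂ, s.Finite ∧ Set.Definable₁ (∅ : Set ℂ) Literature.ModelTheory.ExponentialFields.Language.expRing s ∧ x i ∈ s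

/-- item stmt-Schanuel-0972 · support · rank 9 · closed · proved by Summit.Schanuel.Schanuel.Theorems.logFreeCoreSubsetAcl_proof @ 35f8efd1ceb4 (prover) · by planner
sources: arXiv:1101.4224, Marker2006
[support] Definition audit, provable now (~400 lines): C_EA ⊆ acl^{C_exp}(emptyset). Show
acl(emptyset) (union of finite emptyset-definable sets of (C,+,*,exp), Mathlib Set.Definable₁ over
Language.expRing) is a subfield closed under exp and under roots of polynomials with coefficients in
it (acl is idempotent: definable-with-parameters-from-a-finite-emptyset-definable-set and finite =>
emptyset-definable and finite), and contains 2*pi*i: Z = {m | forall z, exp z = 1 -> exp(m z) = 1}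
is emptyset-definable, so {±2 pi i} = {t | exp t = 1 ∧ forall w, exp w = 1 -> exists m in Z, w = m
t} is a finite emptyset-definable set. Then sInf ≤ acl. A refutation signals a DEFINITION BUG in the
inlined notions. Sources: Marker, Model Theory, sec.1.3/4.1 (acl); KMO arXiv:1101.4224 sec.2.1; card
branch-indiscernibility-rigid-core-v3. -/
@[route_item "route-Schanuel-RigidCore"]
def LogFreeCoreSubsetAcl : Prop :=
  ∀ a : ℂ, a ∈ (sInf {K : IntermediateField ℚ ℂ | (2 * ↑Real.pi * Complex.I : ℂ) ∈ K ∧ (∀ w ∈ K, Complex.exp w ∈ K) ∧ ∀ w : ℂ, IsAlgebraic K w → w ∈ K} : IntermediateField ℚ ℂ) → ∃ s : Set ℂ, s.Finite ∧ Set.Definable₁ (∅ : Set ℂ) Literature.ModelTheory.ExponentialFields.Language.expRing s ∧ a ∈ s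

/-- item stmt-Schanuel-0973 · support · rank 9 · closed · proved by Summit.Schanuel.Schanuel.Theorems.EndomorphismMovingLogTwo_proof (prover) · by planner
sources: arXiv:2209.01027, arXiv:1101.4224, Lindemann1882, Literature.NumberTheory.Transcendental.transcendental_pi_holds (tree, PROVED: Literature/NumberTheory/Transcendental/LindemannWeierstrassProofs.lean:944)
[support] Provable now (~250 lines, Lindemann only): if some ring endomorphism j of C commuting with
exp moves ln 2, then pi and log 2 are algebraically independent over Q. Proof: exp(j(2 pi i)) = 1
gives j(2 pi i) = 2 pi i m; injectivity of j on roots of unity forces m = ±1; replace j by conj∘j if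
m = -1 (conj fixes ln 2), so j(2 pi i) = 2 pi i, j(pi^2) = pi^2 and j(ln 2) = ln 2 + 2 pi i k with k
≠ 0 (Nathanson Thm 2); iterating, P(pi^2, ln 2 + 2 pi i k n) = 0 for all n for any relation P(pi^2,
log 2) = 0 over Q, so P(pi^2, Y) ≡ 0, so pi^2 is algebraic - contradicting transcendental_pi_holds
(tree). Contrapositive: if pi, log 2 are algebraically DEPENDENT then every exponential endomorphism
of C fixes ln 2 (Mycielski's question, AMM Problem 12301; Nathanson arXiv:2209.01027 sec.4, answered
there only mod 2 pi i Z). First 'symmetry => transcendence' theorem of the route; the card's sharper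
forms (endomorphism of the countable core ecl(emptyset); positive-existential branch
indiscernibility BI_2 with Baker hinge B1) await definitions. Sources: card
branch-indiscernibility-rigid-core-v3 T1; arXiv:2209.01027; KMO arXiv:1101.4224 sec.2.1;
Lindemann1882 (tree transcendental_pi_holds). -/
@[route_item "route-Schanuel-RigidCore"]
def EndomorphismMovingLogTwo : Prop :=
  (∃ j : ℂ →+* ℂ, (∀ z : ℂ, j (Complex.exp z) = Complex.exp (j z)) ∧ j (Real.log 2 : ℂ) ≠ (Real.log 2 : ℂ)) → AlgebraicIndependent ℚ ![(Real.pi : ℂ), (Real.log 2 : ℂ)]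

/-- item stmt-Schanuel-0974 · support · rank 9 · closed · proved by Summit.Schanuel.Schanuel.Theorems.oneLogBranchRelationFinite_proof @ a5cb05c21ac7 (prover) · by planner
sources: BakerTNT1975, Lindemann1882, Literature.NumberTheory.Transcendental.baker_holds (tree, PROVED: Literature/NumberTheory/Transcendental/BakerLogarithmsConclusion.lean:1193), Literature.NumberTheory.Transcendental.transcendental_pi_holds (tree, PROVED: Literature/NumberTheory/Transcendental/LindemannWeierstrassProofs.lean:944)
[support] Lemma B1 of card period-lattice-rigidity-baker, provable now over the PROVED tree facts
baker_holds + transcendental_pi_holds (~300 lines): for algebraic alpha ≠ 0 not a root of unity and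
0 ≠ R in Qbar[z,w] not divisible by z - w, R(log alpha + 2 pi i j, log alpha + 2 pi i k) = 0 for
only finitely many (j,k) in Z^2. Proof (refuter-triage-16's transporter argument or the card's
degree bookkeeping): an infinite solution set has Q-Zariski closure containing a Q-curve; comparing
top homogeneous parts forces a Qbar-linear relation among 1, log alpha, 2 pi i, killed by Baker, or
the factor z - w. The unconditional hinge of branch indiscernibility (BI_2 => pi ⊥ log 2). Sources:
card period-lattice-rigidity-baker (B1, S1); BakerTNT1975 Thm 2.1 (tree baker / baker_holds). -/
@[route_item "route-Schanuel-RigidCore"]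
def OneLogBranchRelationFinite : Prop :=
  ∀ (α : ℂ), IsAlgebraic ℚ α → α ≠ 0 → (∀ n : ℕ, 0 < n → α ^ n ≠ 1) → ∀ (R : MvPolynomial (Fin 2) ↥(algebraicClosure ℚ ℂ)), R ≠ 0 → ¬ (MvPolynomial.X 0 - MvPolynomial.X 1 ∣ R) → Set.Finite {p : ℤ × ℤ | MvPolynomial.aeval ![Complex.log α + 2 * ↑Real.pi * Complex.I * (p.1 : ℂ), Complex.log α + 2 * ↑Real.pi * Complex.I * (p.2 : ℂ)] R = 0}

/-- item stmt-Schanuel-0975 · support · rank 9 · closed · proved by Summit.Schanuel.Schanuel.Theorems.TwoLogsBranchRelationFinite_proof (prover) · by planner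
sources: BakerTNT1975, Literature.NumberTheory.Transcendental.baker_holds (tree, PROVED: Literature/NumberTheory/Transcendental/BakerLogarithmsConclusion.lean:1193)
[support] Theorem L (m = 2) of card period-lattice-rigidity-baker, provable now over baker_holds
(~300 lines): for logarithms l1, l2 of algebraic numbers with (l1, l2, 2 pi i) Q-linearly
independent and any non-constant R in Qbar[z,w], R(l1 + 2 pi i j, l2 + 2 pi i k) = 0 for only
finitely many (j,k): 'no algebraic relation between log 2 and log 3 survives on infinitely many
pairs of branches' - AlgIndepLogs generically in the branch, unconditionally. Settles the
finite-y-projection Gamma-symmetric class of SparsityTwo (e.g. W = {y1 = 2, y2 = 3, R(x1,x2) = 0}).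
Sources: card period-lattice-rigidity-baker (Theorem L, COROLLARY m ≤ 2; refuter-triage-16
independent proof); BakerTNT1975 Thm 2.1. -/
@[route_item "route-Schanuel-RigidCore"]
def TwoLogsBranchRelationFinite : Prop :=
  ∀ (l₁ l₂ : ℂ), IsAlgebraic ℚ (Complex.exp l₁) → IsAlgebraic ℚ (Complex.exp l₂) → LinearIndependent ℚ ![l₁, l₂, 2 * ↑Real.pi * Complex.I] → ∀ (R : MvPolynomial (Fin 2) ↥(algebraicClosure ℚ ℂ)), 0 < R.totalDegree → Set.Finite {p : ℤ × ℤ | MvPolynomial.aeval ![l₁ + 2 * ↑Real.pi * Complex.I * (p.1 : ℂ), l₂ + 2 * ↑Real.pi * Complex.I * (p.2 : ℂ)] R = 0}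

/-- item stmt-Schanuel-14765 · support · rank 9 · closed · proved by Summit.Schanuel.Schanuel.Theorems.minimalCounterexampleInAclOfSparsityTwo_proof @ 0d5436928eb8 (prover) · by planner
[support] GLUE for the rank-5 crux SparsityTwo (route-repair 2026-08-16, unused-crux → cone of
`closes`): SparsityTwo → MinimalCounterexampleInAclGeThree → MinimalCounterexampleInAcl. PROVABLE
NOW, ~25 lines — a sorry-free kernel-checked certificate `glue_certificate` (axioms propext /
Classical.choice / Quot.sound) is in the planner sketch attached as evidence; a prover may copy it.
Proof: ranks n ≤ 1 carry no first failure (firstFailure_two_le,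
Theorems/MinimalCounterexampleInAcl/Negative/FirstFailureEcl.lean, landed: rank 0 has trdeg < 0
impossible, rank 1 is Hermite–Lindemann via schanuelRank_one'); rank n = 2: the point (x, eˣ) lies
on some W ⊆ ℂ²×ℂ² defined over the prime field (IsDefinedOver ⊥) with zariskiDim ℂ W < 2 (Literature
exists_definedOver_mem_zariskiDim_lt_iff, TrdegZariskiDimConverse.lean, PROVED; rewrite Set.range
(Sum.elim x (cexp ∘ x)) by Set.Sum.elim_range), every locus mate x' of x (x' ℚ-linearly independent
and (x', e^{x'}) satisfying every ℚ-polynomial relation of (x, eˣ)) has (x', e^{x'}) ∈ W because the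
coefficients of ⊥-polynomials are rational (ratToBot : ℚ →+* ⊥ is surjective since ⊥ ≤ (Rat.castHom
ℂ).fieldRange; MvPolynomial.map_surjective; aeval_map_ -/
@[route_item "route-Schanuel-RigidCore"]
def MinimalCounterexampleInAclOfSparsityTwo : Prop :=
  SparsityTwo → MinimalCounterexampleInAclGeThree → MinimalCounterexampleInAcl

/-- item stmt-Schanuel-0976 · assembly · rank 1 · closed · proved by Summit.Schanuel.Schanuel.Theorems.rigidCore_assembly_proof @ 50c2de0ce228 (prover) · by planner
sources: arXiv:0810.4285
[assembly] MinimalCounterexampleInAcl → AclSubsetLogFreeCore → SchanuelOnLogFreeCore → Schanuel.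
Bookkeeping, staffable now (~15 lines; proved in the planner sketch routes/RigidCore/Sketch.lean,
axioms propext/Classical.choice/Quot.sound): unfold Schanuel to forall n z, LinearIndependent Q z →
n ≤ trdeg; strong induction on n; if trdeg < n then by (S*) with the induction hypothesis
(SchanuelRank r, r < n, is the n-slice verbatim) every z i ∈ acl(emptyset) ⊆ C_EA by (A), and (R)
gives n ≤ trdeg, contradiction. Sources: card branch-indiscernibility-rigid-core-v3 (Assembly sketch
T3). -/
@[route_item "route-Schanuel-RigidCore"]
def Assembly : Prop :=
  MinimalCounterexampleInAcl → AclSubsetLogFreeCore → SchanuelOnLogFreeCore → Schanuel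

/-! D-0027 §2.1 — DECIDING THEOREM (planner-authored via `route open/edit --closes-file`; by planner-rbadge-Schanuel-RigidCore-f6f840d7-g2-0 2026-08-15T16:11:27Z):
its hypotheses are this route's items and its conclusion the sub-problem Statement (glue_lint), and it elaborates with this file. -/

/-- DECIDING THEOREM (D-0027 §2.1): the three localisation cruxes decide Schanuel's conjecture.
Strong induction on the rank `n`: a first failure at rank `n` (all `SchanuelRank r`, `r < n`, hold by
the induction hypothesis) has every coordinate in acl^{ℂ_exp}(∅) by (S*), hence in the log-free core
C_EA by (A), where (R) gives `n ≤ trdeg` — contradiction. -/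
@[closes "route-Schanuel-RigidCore"] theorem closes (hS : MinimalCounterexampleInAcl) (hA : AclSubsetLogFreeCore)
    (hR : SchanuelOnLogFreeCore) : _root_.Schanuel := by
  show ∀ (n : ℕ) (z : Fin n → ℂ), LinearIndependent ℚ z →
    (n : Cardinal) ≤ Algebra.trdeg ℚ
      ↥(IntermediateField.adjoin ℚ (Set.range z ∪ Set.range (Complex.exp ∘ z)))
  intro n
  induction n using Nat.strong_induction_on with
  | _ n ih =>
    intro z hz
    by_contra hlt
    have hlt' : Algebra.trdeg ℚ
        ↥(IntermediateField.adjoin ℚ (Set.range z ∪ Set.range (Complex.exp ∘ z))) < (n : Cardinal) :=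
      lt_of_not_ge hlt
    have hrank : ∀ r < n, Literature.NumberTheory.Transcendental.SchanuelRank r :=
      fun r hr => ih r hr
    have hmem := fun i => hA (z i) (hS n z hz hlt' hrank i)
    exact hlt (hR n z hmem hz)

end Summit.Schanuel.Schanuel.Theses.RigidCore
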